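import Summits.CriticalPhenomena.PercolationContinuityZ3.Theorems.SahiMasterFamilyLift
import Summits.CriticalPhenomena.PercolationContinuityZ3.Theorems.SahiMasterFamilyHeredity

/-!
# The pointwise equality conjecture contains the positivity conjecture: `MasterFamilyEqIff k → MasterFamilyNonneg k`

Companion of `SahiMasterFamily.lean` (crux `NoHeavyLowerTail`, stmt-CriticalPhenomena-4575; cell `prim-l12`, unit
`prim-master-conj`).  `SahiMasterFamily.lean` states two halves of the "master conjecture" for Sahi's functionals
`E_k` [Sahi2008; LiebSahi2021] of `k` increasing events under a product measure `μ_p`: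
positivity `MasterFamilyNonneg k` (`E_k ≥ 0` on `[0,1]^ι`; `k = 3` is Kahn's Conjecture 5 [Kahn2022]) and the
POINTWISE equality locus `MasterFamilyEqIff k` (for each `p` in the open cube, `E_k(μ_p; 1_U) = 0 ↔ U ∈ Z_k`, the
`p`-free zero-flag class).  THIS FILE PROVES that the second contains the first:

  `masterFamilyNonneg_of_masterFamilyEqIff : MasterFamilyEqIff k → MasterFamilyNonneg k`   (every `k`),

so in particular `MasterFamilyEqIff 3 → KahnConjecture` (`kahnConjecture_of_masterFamilyEqIff_three`): the pointwise
form of the cell's equality conjecture (EQ-3) is at least as hard as Kahn's "thoroughly intractable" Conjecture 5,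
and the honest combinatorial target is the IDENTICALLY-ZERO form (`E_k ≡ 0` on the open cube `↔ Z_k`), which does
not contain `C_k` (see `SahiMasterFamilyIdent.lean`).

Proof.  Suppose `E_k(μ_p; 1_U) < 0` at an interior `p` (WLOG every `U_j ≠ ∅`, else `E_k = 0` by multilinearity).
Lift to `Option ι`, the new coordinate open with probability `t`, `LU_j = U_j ∧ [none open]`
(`SahiMasterFamilyLift.lean`).  Then `Φ(t) = E_k(μ_{(p,t)}; 1_{LU})` is continuous in `t`, equals
`t·(k−1)!·μ_p(⋂_j U_j) + O(t²) > 0` for small `t > 0`, and `Φ(1) = E_k(μ_p; 1_U) < 0`; so `Φ(t*) = 0` at some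
interior `t*`.  `MasterFamilyEqIff k` at the interior point `(p, t*)` puts `LU` in the `p`-FREE class `Z_k`, and the
proved half `Z_k ⇒ E_k = 0` (`masterFamilyEqIff_mpr`, every parameter) gives `Φ ≡ 0` — contradicting `Φ > 0` near
`0`.  The closed cube follows by continuity (`masterFamilyNonneg_of_open`). [this work]
-/

noncomputable section

open scoped Classical

namespace Summit.CriticalPhenomena.PercolationContinuityZ3.Theorems

open Finset Function MeasureTheory Filter Topology
open Literature.Combinatorics.Sahi2008
open Literature.Probability.Percolation (DeterminedBy)
open Literature.Probability.Percolation.DecisionTree (ind ind_of_mem ind_of_not_mem ind_nonneg)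

/-! ### The theorem -/

section Main

/-- **Pointwise equality ⇒ positivity, open cube.** If `MasterFamilyEqIff k` holds then `E_k(μ_p; 1_U) ≥ 0` for
every `p` in the open cube and every `k` increasing events.  Proof: if `E_k(μ_p; 1_U) < 0`, lift to `Option ι`
with the new coordinate open with probability `t`; `t ↦ E_k(μ_{(p,t)}; 1_{LU})` is continuous, equals
`t·(k−1)!·μ_p(∩ U_j) + O(t²) > 0` for small `t > 0` and `E_k(μ_p; 1_U) < 0` at `t = 1`, so it vanishes at some
interior `t*`; `MasterFamilyEqIff` puts `LU` in the `p`-free class `Z_k`, whence (`masterFamilyEqIff_mpr`) the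
lifted functional vanishes for EVERY `t` — contradiction at small `t`. [this work] -/
theorem sahiE_ind_nonneg_of_masterFamilyEqIff {k : ℕ} (hEq : MasterFamilyEqIff k) {ι : Type} [Fintype ι]
    (p : ι → unitInterval) (hp : ∀ e, (p e : ℝ) ∈ Set.Ioo (0 : ℝ) 1) (U : Fin k → Set (Set ι))
    (hU : ∀ j, IsUpperSet (U j)) : 0 ≤ sahiE (bernoulliWeight p) k (fun j => ind (U j)) := by
  rcases k with _ | n
  · simp [sahiE_zero]
  by_contra hneg
  push Not at hneg
  -- every `U j` is nonempty (contains `univ`), else `E_k = 0`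
  have hne : ∀ j, Set.univ ∈ U j := by
    intro j
    by_contra hj
    have hempty : U j = ∅ := Set.eq_empty_of_forall_notMem fun ω hω => hj (hU j (Set.subset_univ ω) hω)
    have hupd : (fun j => ind (U j)) = update (fun j => ind (U j)) j 0 := by
      funext i
      by_cases hi : i = j
      · subst hi
        rw [update_self, hempty]
        funext ω
        exact ind_of_not_mem (Set.notMem_empty ω)
      · rw [update_of_ne hi]
    rw [hupd, sahiE_update_zero] at hneg
    exact lt_irrefl _ hneg
  set F : Fin (n + 1) → Set ι → ℝ := fun j => ind (U j) with hFdef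
  -- the top block moment is positive
  have hX : 0 < ex (bernoulliWeight p) (∏ j, F j) := by
    simp only [ex]
    have hterm : ∀ ω ∈ (univ : Finset (Set ι)), 0 ≤ bernoulliWeight p ω * (∏ j, F j) ω := fun ω _ =>
      mul_nonneg (bernoulliWeight_pos hp ω).le (by rw [Finset.prod_apply]; exact prod_nonneg fun j _ => ind_nonneg _ _)
    refine lt_of_lt_of_le ?_ (single_le_sum hterm (mem_univ Set.univ))
    have h1 : (∏ j, F j) Set.univ = 1 := by
      rw [Finset.prod_apply]; exact prod_eq_one fun j _ => ind_of_mem (hne j)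
    rw [h1, mul_one]
    exact bernoulliWeight_pos hp _
  -- the lifted events
  set U' : Fin (n + 1) → Set (Set (Option ι)) := fun j => liftEvent (U j) with hU'def
  have hU' : ∀ j, IsUpperSet (U' j) := fun j => isUpperSet_liftEvent (hU j)
  have hF' : (fun j => ind (U' j)) = fun j => liftFun (F j) := by
    funext j; exact ind_liftEvent (U j)
  -- the path
  set Φ : ℝ → ℝ := fun t =>
    sahiE (bernoulliWeight (liftP p (Set.projIcc 0 1 zero_le_one t))) (n + 1) (fun j => liftFun (F j)) with hΦdef
  have hΦc : Continuous Φ :=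
    (continuous_sahiE_bernoulliWeight (n + 1) _).comp ((continuous_liftP p).comp continuous_projIcc)
  have hΦ1 : Φ 1 = sahiE (bernoulliWeight p) (n + 1) F := by
    simp only [hΦdef]
    rw [Set.projIcc_right]
    exact sahiE_lift_one p n F _ rfl
  obtain ⟨M, hM⟩ := sahiE_lift_expansion p n F
  set a := (n.factorial : ℝ) * ex (bernoulliWeight p) (∏ j, F j) with hadef
  have ha : 0 < a := mul_pos (by positivity) hX
  -- a small parameter with `Φ t₀ > 0`
  set t₀ : ℝ := a / (a + |M| + 1) with ht₀def
  have hden : 0 < a + |M| + 1 := by positivity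
  have ht₀0 : 0 < t₀ := div_pos ha hden
  have ht₀1 : t₀ < 1 := by rw [ht₀def, div_lt_one hden]; linarith [abs_nonneg M]
  have hMt : M * t₀ < a := by
    have h1 : M * t₀ ≤ |M| * t₀ := mul_le_mul_of_nonneg_right (le_abs_self M) ht₀0.le
    have h2 : |M| * t₀ < a := by
      rw [ht₀def, ← mul_div_assoc, div_lt_iff₀ hden]
      nlinarith [abs_nonneg M]
    linarith
  have hΦt₀ : 0 < Φ t₀ := by
    have ht₀I : t₀ ∈ Set.Icc (0 : ℝ) 1 := ⟨ht₀0.le, ht₀1.le⟩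
    have h := hM (Set.projIcc 0 1 zero_le_one t₀)
    rw [Set.projIcc_of_mem _ ht₀I] at h
    have h' := (abs_le.1 h).1
    have hΦt : Φ t₀ = sahiE (bernoulliWeight (liftP p ⟨t₀, ht₀I⟩)) (n + 1) (fun j => liftFun (F j)) := by
      simp only [hΦdef]; rw [Set.projIcc_of_mem _ ht₀I]
    rw [hΦt]
    have : (0 : ℝ) < t₀ * a - M * t₀ ^ 2 := by nlinarith
    simp only at h'
    nlinarith
  -- an interior zero
  have hsub := intermediate_value_Icc' ht₀1.le hΦc.continuousOn
  have h0mem : (0 : ℝ) ∈ Set.Icc (Φ 1) (Φ t₀) := ⟨by rw [hΦ1]; exact hneg.le, hΦt₀.le⟩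
  obtain ⟨s, hs, hΦs⟩ := hsub h0mem
  have hs1 : s < 1 := lt_of_le_of_ne hs.2 fun h => by
    rw [h, hΦ1] at hΦs; exact hneg.ne hΦs
  have hs0 : 0 < s := ht₀0.trans_le hs.1
  have hsI : s ∈ Set.Icc (0 : ℝ) 1 := ⟨hs0.le, hs1.le⟩
  set ps : Option ι → unitInterval := liftP p ⟨s, hsI⟩ with hpsdef
  have hps : ∀ i, (ps i : ℝ) ∈ Set.Ioo (0 : ℝ) 1 := by
    intro i
    cases i with
    | none => exact ⟨hs0, hs1⟩
    | some e => exact hp e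
  have hzero : sahiE (bernoulliWeight ps) (n + 1) (fun j => ind (U' j)) = 0 := by
    rw [hF', hpsdef]
    have : Φ s = sahiE (bernoulliWeight (liftP p ⟨s, hsI⟩)) (n + 1) (fun j => liftFun (F j)) := by
      simp only [hΦdef]; rw [Set.projIcc_of_mem _ hsI]
    rw [← this]; exact hΦs
  have hZ : SuppZeroFlag (n + 1) U' := (hEq (Option ι) ps hps U' hU').1 hzero
  -- hence zero for every `t`, in particular `t₀`
  have ht₀I : t₀ ∈ Set.Icc (0 : ℝ) 1 := ⟨ht₀0.le, ht₀1.le⟩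
  have hall := masterFamilyEqIff_mpr (n + 1) (Option ι) (liftP p ⟨t₀, ht₀I⟩) U' hZ
  rw [hF'] at hall
  have hΦt : Φ t₀ = sahiE (bernoulliWeight (liftP p ⟨t₀, ht₀I⟩)) (n + 1) (fun j => liftFun (F j)) := by
    simp only [hΦdef]; rw [Set.projIcc_of_mem _ ht₀I]
  rw [← hΦt] at hall
  exact hΦt₀.ne' hall

/-- **The pointwise equality conjecture contains the positivity conjecture**: `MasterFamilyEqIff k → MasterFamilyNonneg k`
for every `k`.  In particular the conjectured zero locus `E_k = 0 ⟺ Z_k` AT A SINGLE interior `p` is at least as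
strong as Sahi's `C_k` for product measures; for `k = 3` it implies Kahn's Conjecture 5
(`kahnConjecture_of_masterFamilyEqIff_three`). [this work] -/
theorem masterFamilyNonneg_of_masterFamilyEqIff {k : ℕ} (hEq : MasterFamilyEqIff k) : MasterFamilyNonneg k :=
  masterFamilyNonneg_of_open k fun _ _ p hp U hU => sahiE_ind_nonneg_of_masterFamilyEqIff hEq p hp U hU

/-- **`MasterFamilyEqIff 3` implies Kahn's Conjecture 5** (`E_3 ≥ 0` for three increasing events under any product
measure). [this work] -/
theorem kahnConjecture_of_masterFamilyEqIff_three (h : MasterFamilyEqIff 3) : KahnConjecture :=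
  masterFamilyNonneg_three_iff_kahnConjecture.1 (masterFamilyNonneg_of_masterFamilyEqIff h)

/-- **Heredity of zeros at order 3 implies Kahn's Conjecture 5**: if `E_3(μ_p; 1_A,1_B,1_C) = 0` (interior `p`,
increasing events) always forces some pair to be uncorrelated, then `E_3 ≥ 0` for all triples of increasing events
under every product measure (`MasterFamilyHeredity 3 ↔ MasterFamilyEqIff 3 → MasterFamilyNonneg 3 ↔ KahnConjecture`).
[this work] -/
theorem kahnConjecture_of_masterFamilyHeredity_three (h : MasterFamilyHeredity 3) : KahnConjecture :=
  kahnConjecture_of_masterFamilyEqIff_three (masterFamilyEqIff_three_iff_heredity.2 h)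

/-- **Summary of the logical position of the pointwise equality conjecture at order 3**:
`MasterFamilyEqIff 3 ↔ MasterFamilyHeredity 3`, and either implies `KahnConjecture` and `MasterFamilyIdentEqIff 3`.
[this work] -/
theorem masterFamilyEqIff_three_consequences (h : MasterFamilyEqIff 3) :
    MasterFamilyHeredity 3 ∧ KahnConjecture ∧ MasterFamilyIdentEqIff 3 :=
  ⟨masterFamilyEqIff_three_iff_heredity.1 h, kahnConjecture_of_masterFamilyEqIff_three h,
    masterFamilyIdentEqIff_of_eqIff h⟩

end Main

end Summit.CriticalPhenomena.PercolationContinuityZ3.Theorems
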